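import Mathlib
import Summits.NavierStokesRegularity.NavierStokesRegularity.Theses.PerpetualPump

/-!
# Sketch (ideator 2, round 1) — first lemmas for the crux ideas `wire-decoupling`
# and `conformal-clock` on crux `CircuitPump` (stmt-NavierStokesRegularity-1834).

Statements only need to ELABORATE (crux-ideate stage); proofs are `sorry` unless trivial.
-/

noncomputable section

namespace Summit.NavierStokesRegularity.NavierStokesRegularity.Cruxes.CircuitPump.Ideator2

open Real Finset BigOperators

/-! ## The crux system, as standalone definitions (verbatim copy of the route decl's body) -/

/-- shell offset of the FIRST factor for offset label `μ` (`some 0 ↦ +1`, `some 2 ↦ -1`). -/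
def off₁ (μ : Option (Fin 3)) : ℤ :=
  (if μ = some 0 then 1 else 0) - (if μ = some 2 then 1 else 0)

/-- shell offset of the SECOND factor for offset label `μ` (`some 1 ↦ +1`, `some 2 ↦ -1`). -/
def off₂ (μ : Option (Fin 3)) : ℤ :=
  (if μ = some 1 then 1 else 0) - (if μ = some 2 then 1 else 0)

/-- The quadratic (inviscid) part of the crux right-hand side. -/
def quadRHS (lam : ℝ) {m : ℕ} (coeff : Fin m → Fin m → Fin m → Option (Fin 3) → ℝ)
    (X : Fin m → ℤ → ℝ → ℝ) (i : Fin m) (n : ℤ) (t : ℝ) : ℝ :=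
  ∑ i₁ : Fin m, ∑ i₂ : Fin m, ∑ μ : Option (Fin 3),
    coeff i₁ i₂ i μ * lam ^ ((n : ℝ) - (if μ = some 2 then 1 else 0)) *
      X i₁ (n + ((if μ = some 0 then 1 else 0) - (if μ = some 2 then 1 else 0))) t *
      X i₂ (n + ((if μ = some 1 then 1 else 0) - (if μ = some 2 then 1 else 0))) t

/-- The full (viscous) crux right-hand side `F i n t`. -/
def circuitRHS (lam : ℝ) {m : ℕ} (coeff : Fin m → Fin m → Fin m → Option (Fin 3) → ℝ)
    (X : Fin m → ℤ → ℝ → ℝ) (i : Fin m) (n : ℤ) (t : ℝ) : ℝ :=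
  -(lam ^ ((4 / 5 : ℝ) * n)) * X i n t + quadRHS lam coeff X i n t

/-- Tao's symmetry (4.2) in the crux encoding. -/
def IsSym {m : ℕ} (coeff : Fin m → Fin m → Fin m → Option (Fin 3) → ℝ) : Prop :=
  ∀ (i₁ i₂ i₃ : Fin m) (μ : Option (Fin 3)),
    coeff i₁ i₂ i₃ μ = coeff i₂ i₁ i₃ (Option.map (Equiv.swap (0 : Fin 3) 1) μ)

/-- Cyclic cancellation (energy conservation) in the crux encoding. -/
def IsCyc {m : ℕ} (coeff : Fin m → Fin m → Fin m → Option (Fin 3) → ℝ) : Prop :=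
  ∀ (v : Fin 3 → Fin m) (μ : Option (Fin 3)),
    ∑ σ : Equiv.Perm (Fin 3), coeff (v (σ 0)) (v (σ 1)) (v (σ 2)) (Option.map σ.symm μ) = 0

/-- The body of `CircuitPump` at a FIXED scale ratio `lam` and period `k` (verbatim). -/
def PumpBody (lam : ℝ) (m : ℕ) (coeff : Fin m → Fin m → Fin m → Option (Fin 3) → ℝ) (k : ℕ)
    (X : Fin m → ℤ → ℝ → ℝ) : Prop :=
  let F : Fin m → ℤ → ℝ → ℝ := fun (i : Fin m) (n : ℤ) (t : ℝ) => -(lam ^ ((4 / 5 : ℝ) * n)) * X i n t + ∑ i₁ : Fin m, ∑ i₂ : Fin m, ∑ μ : Option (Fin 3), coeff i₁ i₂ i μ * lam ^ ((n : ℝ) - (if μ = some 2 then 1 else 0)) * X i₁ (n + ((if μ = some 0 then 1 else 0) - (if μ = some 2 then 1 else 0))) t * X i₂ (n + ((if μ = some 1 then 1 else 0) - (if μ = some 2 then 1 else 0))) t; (∀ (i₁ i₂ i₃ : Fin m) (μ : Option (Fin 3)), coeff i₁ i₂ i₃ μ = coeff i₂ i₁ i₃ (Option.map (Equiv.swap (0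 : Fin 3) 1) μ)) ∧ (∀ (v : Fin 3 → Fin m) (μ : Option (Fin 3)), ∑ σ : Equiv.Perm (Fin 3), coeff (v (σ 0)) (v (σ 1)) (v (σ 2)) (Option.map σ.symm μ) = 0) ∧ 1 ≤ k ∧ (∀ (i : Fin m) (n : ℤ) (t : ℝ), t < 0 → HasDerivAt (X i n) (F i n t) t) ∧ (∀ (i : Fin m) (n : ℤ) (t : ℝ), t < 0 → X i (n + k) (lam ^ (-((4 / 5 : ℝ) * k)) * t) = lam ^ (-((1 / 5 : ℝ) * k)) * X i n t) ∧ (∃ C : ℝ, ∀ (i : Fin m) (n : ℤ) (t : ℝ), t < 0 → lam ^ ((3 / 5 : ℝ) * n) * |X i n t| ≤ C / Real.sqrt (-t)) ∧ (∃ (i : Fin m) (n : ℤ) (t : ℝ), t < 0 ∧ X i n t ≠ 0)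

/-- "There is a Type-I DSS pump of period `k` at scale ratio `lam`". -/
def PumpAt (lam : ℝ) (k : ℕ) : Prop :=
  ∃ (m : ℕ) (coeff : Fin m → Fin m → Fin m → Option (Fin 3) → ℝ) (X : Fin m → ℤ → ℝ → ℝ),
    PumpBody lam m coeff k X

/-! ## wire-decoupling, first lemma (a): COARSE PERIOD ON A FINE LATTICE
If for one FIXED coarse ratio `Λ > 1` there are period-`p` pumps at `lam = Λ^{1/p}` for all large
`p`, the crux follows (choose `p > log Λ / log lam₀`). Pure bookkeeping. -/

theorem exists_root_lt (Λ lam₀ : ℝ) (hΛ : 1 < Λ) (h₀ : 1 < lam₀) (p₀ : ℕ) :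
    ∃ p : ℕ, p₀ ≤ p ∧ 0 < p ∧ 1 < Λ ^ (1 / (p : ℝ)) ∧ Λ ^ (1 / (p : ℝ)) < lam₀ := by
  have hΛpos : 0 < Λ := by linarith
  have hlog₀ : 0 < Real.log lam₀ := Real.log_pos h₀
  have hlogΛ : 0 < Real.log Λ := Real.log_pos hΛ
  obtain ⟨p, hp⟩ := exists_nat_gt (max (p₀ : ℝ) (Real.log Λ / Real.log lam₀))
  have hp₀' : (p₀ : ℝ) < p := lt_of_le_of_lt (le_max_left _ _) hp
  have hq : Real.log Λ / Real.log lam₀ < p := lt_of_le_of_lt (le_max_right _ _) hp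
  have hqpos : 0 < Real.log Λ / Real.log lam₀ := div_pos hlogΛ hlog₀
  have hppos : (0 : ℝ) < p := lt_trans hqpos hq
  refine ⟨p, by exact_mod_cast hp₀'.le, by exact_mod_cast hppos, ?_, ?_⟩
  · exact Real.one_lt_rpow hΛ (by positivity)
  · rw [Real.rpow_def_of_pos hΛpos]
    have hq' : Real.log Λ < p * Real.log lam₀ := by rwa [div_lt_iff₀ hlog₀] at hq
    calc Real.exp (Real.log Λ * (1 / (p : ℝ))) < Real.exp (Real.log lam₀) := by
          apply Real.exp_lt_exp.mpr
          have h1 : Real.log Λ * (1 / (p : ℝ)) = Real.log Λ / p := by ring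
          rw [h1, div_lt_iff₀ hppos]
          linarith
      _ = lam₀ := Real.exp_log (by linarith)

theorem circuitPump_of_coarseFamily (Λ : ℝ) (hΛ : 1 < Λ) (p₀ : ℕ)
    (h : ∀ p : ℕ, p₀ ≤ p → 0 < p → PumpAt (Λ ^ (1 / (p : ℝ))) p) :
    Summit.NavierStokesRegularity.NavierStokesRegularity.Theses.PerpetualPump.CircuitPump := by
  intro lam₀ hlam₀
  obtain ⟨p, hp₀, hp, h1, hlt⟩ := exists_root_lt Λ lam₀ hΛ hlam₀ p₀
  obtain ⟨m, coeff, X, hB⟩ := h p hp₀ hp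
  exact ⟨Λ ^ (1 / (p : ℝ)), h1, hlt, m, coeff, p, X, hB⟩

/-! ## wire-decoupling, first lemma (b): GRADED ALPHABETS GIVE PERIODIC ROLES
A ℤ/p-grading `phase` of the mode alphabet such that every nonzero structure constant sends two
on-grade factors to an on-grade target makes the subspace
`V = {X | X i s · = 0 whenever phase i ≠ s mod p}` invariant for the vector field: on `V` the
autonomous, shell-homogeneous circuit acts with `p`-PERIODIC roles along the shells. -/

/-- grading compatibility of the structure constants with a phase map. -/
def IsGradedCoeff {m : ℕ} (p : ℕ) (phase : Fin m → ZMod p)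
    (coeff : Fin m → Fin m → Fin m → Option (Fin 3) → ℝ) : Prop :=
  ∀ (i₁ i₂ i₃ : Fin m) (μ : Option (Fin 3)), coeff i₁ i₂ i₃ μ ≠ 0 →
    phase i₁ - (off₁ μ : ZMod p) = phase i₂ - (off₂ μ : ZMod p) →
      phase i₃ = phase i₁ - (off₁ μ : ZMod p)

theorem graded_rhs_vanishes_offgrade {m : ℕ} (p : ℕ) (phase : Fin m → ZMod p) (lam : ℝ)
    (coeff : Fin m → Fin m → Fin m → Option (Fin 3) → ℝ) (hg : IsGradedCoeff p phase coeff)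
    (X : Fin m → ℤ → ℝ → ℝ) (hV : ∀ (i : Fin m) (s : ℤ) (t : ℝ), phase i ≠ (s : ZMod p) → X i s t = 0)
    (i : Fin m) (n : ℤ) (t : ℝ) (hi : phase i ≠ (n : ZMod p)) :
    circuitRHS lam coeff X i n t = 0 := by
  sorry

/-! ## conformal-clock, first lemma: SHELL-WISE UNIFORM DAMPING IS A GAUGE
All modes of shell `n` are damped at the same rate `ν_n = lam^{4n/5}` and the nonlinearity is
homogeneous quadratic, so `Y_{i,n}(t) = e^{ν_n (t - t_n)} X_{i,n}(t)` satisfies an equation with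
NO damping term; for same-shell interactions the conjugacy with the inviscid system is exact after
the clock change `dθ_n = e^{-ν_n (t - t_n)} dt`, and `e^{-ν_n (t-t_n)} = 1 - ν_n θ_n` exactly. -/

theorem gauge_hasDerivAt (lam : ℝ) {m : ℕ} (coeff : Fin m → Fin m → Fin m → Option (Fin 3) → ℝ)
    (X : Fin m → ℤ → ℝ → ℝ) (i : Fin m) (n : ℤ) (t tn : ℝ)
    (hX : HasDerivAt (X i n) (circuitRHS lam coeff X i n t) t) :
    HasDerivAt (fun s => Real.exp (lam ^ ((4 / 5 : ℝ) * n) * (s - tn)) * X i n s)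
      (Real.exp (lam ^ ((4 / 5 : ℝ) * n) * (t - tn)) * quadRHS lam coeff X i n t) t := by
  have h0 : HasDerivAt (fun s => lam ^ ((4 / 5 : ℝ) * n) * (s - tn))
      (lam ^ ((4 / 5 : ℝ) * n) * 1) t :=
    ((hasDerivAt_id t).sub_const tn).const_mul _
  have h2 := (h0.exp).mul hX
  refine h2.congr_deriv ?_
  simp only [circuitRHS]
  ring

/-- Exact conjugacy for SAME-SHELL circuits: if `coeff` only charges the offset `none = (0,0,0)`,
the gauged amplitudes solve the INVISCID system with the scalar clock factor `e^{-ν_n (t - t_n)}`. -/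
theorem sameShell_gauge_conjugacy (lam : ℝ) {m : ℕ}
    (coeff : Fin m → Fin m → Fin m → Option (Fin 3) → ℝ)
    (honly : ∀ (i₁ i₂ i₃ : Fin m) (μ : Option (Fin 3)), μ ≠ none → coeff i₁ i₂ i₃ μ = 0)
    (X : Fin m → ℤ → ℝ → ℝ) (n : ℤ) (tn : ℝ)
    (hX : ∀ (i : Fin m) (t : ℝ), t < 0 → HasDerivAt (X i n) (circuitRHS lam coeff X i n t) t) :
    let ν : ℝ := lam ^ ((4 / 5 : ℝ) * n)
    let Y : Fin m → ℤ → ℝ → ℝ := fun i n' s => Real.exp (ν * (s - tn)) * X i n' s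
    ∀ (i : Fin m) (t : ℝ), t < 0 →
      HasDerivAt (Y i n) (Real.exp (-(ν * (t - tn))) * quadRHS lam coeff Y i n t) t := by
  sorry

/-- The clock: `θ(t) = (1 - e^{-ν (t - t_n)})/ν` has `θ' = e^{-ν (t - t_n)}` and the EXACT law
`e^{-ν (t - t_n)} = 1 - ν θ(t)` (so the physical amplitude handed on after an inviscid hop of
clock-duration `θ_hop` is reduced by exactly the factor `1 - ν θ_hop`). -/
theorem clock_law (ν tn t : ℝ) (hν : ν ≠ 0) :
    HasDerivAt (fun s => (1 - Real.exp (-(ν * (s - tn)))) / ν) (Real.exp (-(ν * (t - tn)))) t ∧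
    Real.exp (-(ν * (t - tn))) = 1 - ν * ((1 - Real.exp (-(ν * (t - tn)))) / ν) := by
  constructor
  · sorry
  · field_simp
    ring

/-! ## multiplicative exclusion (design constraint honoured by both ideas; rigorous and short):
a mode whose equation has no `X_{i,n}`-free monomial cannot appear in a Type-I solution on
`(-∞,0)` unless it vanishes identically (backward growth `e^{ν_n |t|}` beats the Type-I envelope). -/
theorem multiplicative_mode_vanishes (ν C : ℝ) (hν : 0 < ν) (x L : ℝ → ℝ)
    (hx : ∀ t < 0, HasDerivAt x ((-ν + L t) * x t) t)
    (hL : ∀ t < 0, |L t| ≤ C / Real.sqrt (-t))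
    (hTypeI : ∃ C' : ℝ, ∀ t < 0, |x t| ≤ C' / Real.sqrt (-t)) :
    ∀ t < 0, x t = 0 := by
  sorry

end Summit.NavierStokesRegularity.NavierStokesRegularity.Cruxes.CircuitPump.Ideator2

end
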